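import Summits.CriticalPhenomena.PercolationContinuityZ3.Theorems.Transplant.KNCellsBoxProdZ2ChainT
import Summits.CriticalPhenomena.PercolationContinuityZ3.Theorems.Transplant.KNCells2CorridorEdge
import Summits.CriticalPhenomena.PercolationContinuityZ3.Theorems.Transplant.KNCells2Face
import HarnessLib

/-!
# Design (D), order G4 — THE TWO PACKAGING THEOREMS over `X □ ℤ²`: `hreach` from a TUBE CORRIDOR CHAIN and `cond_j` (`hface_j`) from ONE TUBE
# STEP, for any lag-1 anchored scheme `S : KSchA (W × Site 2) A` (lead V56 / §11 v2 of HOME/ENTRY-SEED-STAR.md; the per-step inputs are exactly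
# p3-g2's I2 obligations — `kitClauseQ`'s kit clause, the subbox property of the restricted law in the tube graph, the collar excess of the rim parts)

builds on p205010 (kernel theorem, internal audit signed; external expert review pending) — nothing in this file uses p205010.
Lane `prim-bschramm`, seat `prim-bschramm-p2` (G4); helper file (`--supports stmt-CriticalPhenomena-4575`).

* **`hreach_of_tubeChain`** — `KSchA.hreach_of_chain_edge_sub` (p216676) specialised to `TubeChainData.stepE` / true targets `tgtT`: after a valid
  history, a chain property for the tube graph (stmt's `chain_edge_tube`/`_subgraph`), per step the kit clause + subbox + support facts + the rim
  excess `P_{Wcor}(root ↔ Rim_i) ≤ η ≤ δ/2`, the arrival cube inside `π' × M_x ⊆ X^{(0)}_0` and the last true target inside `M^{a'}_{x+du}` give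
  `1 - ε'' < P_{Wfull}(Reach h e (aOf₁) a' du)`.
* **`cond_of_tubeStep`** — `KSchA.cond_of_step` (p217114) specialised to `TubeStepData.tstep`: one step whose first level contains the face
  `F^{j+1}`, true target `T' ⊆ M^{a'}_{x+du}` inside the enlarged target, excess `≤ η ≤ δc/2`, turns `1 - δ₂ < P_{Wt}(root ↔ F^{j+1})` into `cond`.
[cite: KozmaNitzan2024, §4 p. 30 (Steps III–IV), Lemma 10 (p. 17), Lemma 12 (pp. 23–25)]
-/

noncomputable section

open MeasureTheory ProbabilityTheory
open scoped ENNReal Classical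

namespace Summit.CriticalPhenomena.PercolationContinuityZ3.Theorems

namespace Transplant

namespace KNCells

open Literature.Probability.Percolation Literature.Probability.LatticeModels SimpleGraph GadgetSystem ProbeHistory HSiteScheme Contour
open BoxProdZ2

variable {W : Type} [DecidableEq W] [Countable W] (X : SimpleGraph W) [X.LocallyFinite]

namespace KSchA

variable {A : Type*} {S : KSchA (W × Site 2) A} {FD : FaceData (W × Site 2) A}
variable {h : ProbeHistory (W × Site 2)} {e : Site 2 × MDir} {a a' : A} {du : MDir}

/-- **`hreach` FROM A TUBE CORRIDOR CHAIN** (design (D)). [cite: KozmaNitzan2024, §4 Lemma 12 (pp. 23–25), p. 30 (Step IV)] -/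
theorem hreach_of_tubeChain (P : TubeChainData W) (hV : S.Valid₂ (X □ zdGraph 2) h e) {Δ' : ℕ} {δ ε'' η : ℝ}
    (hδc : S.δc ≤ δ)
    (hchain : ∀ (Wg : Sym2 (W × Site 2) → unitInterval) (s : Fin (ChainPlanar.Sched.nLast + 1) → KNLevels.TStep (tubeGraph X P.π))
      (T' : Fin (ChainPlanar.Sched.nLast + 1) → Finset (W × Site 2)) (η : ℝ),
      (∀ i, (s i).L.o = (s 0).L.o) →
      (∀ i : Fin ChainPlanar.Sched.nLast, T' (Fin.castSucc i) ⊆ (s i.succ).L.X 0) →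
      (∀ i, T' i ⊆ (s i).T) →
      (∀ i, (s i).KitsAt Wg S.p Δ' δ) →
      η ≤ δ / 2 →
      (∀ i, (prodBernoulli Wg).real (⋃ t ∈ (s i).T \ T' i, openConn (s 0).L.o t) ≤ η) →
      1 - δ < (prodBernoulli Wg).real (s 0).L.reachB →
        1 - ε'' < (prodBernoulli Wg).real (⋃ t ∈ T' (Fin.last ChainPlanar.Sched.nLast), openConn (s 0).L.o t))
    (hroot : P.root = S.Γ.root)
    (hr : P.C.r = 4 * P.t) (hR : 100 * P.R' ≤ P.t) (hRl : P.Rlev + 1 ≤ P.R') (hRim : ∀ i, P.Rim i ⊆ P.stepD i) (hπ : P.π.Nonempty)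
    (hj : P.j₁ ≤ P.Rlev) (hcount : 1 / (1 - (S.p : ℝ)) ^ (Δ' * P.N) ≤ δ * ((Finset.Icc P.j₀ P.j₁).card : ℝ))
    (hsub : ∀ i ≤ ChainPlanar.Sched.nLast,
      KNLevels.IsSubbox (tubeGraph X P.π) (S.Wcor (X □ zdGraph 2) FD h e (S.aOf₁ (X □ zdGraph 2) h e) a' du) S.p (P.stepD i))
    (hfin : KNLevels.FinSupp (S.Wcor (X □ zdGraph 2) FD h e (S.aOf₁ (X □ zdGraph 2) h e) a' du) P.Sfin)
    (hDS : ∀ i ≤ ChainPlanar.Sched.nLast, P.stepD i ⊆ P.Sfin) (ho : ∀ i ≤ ChainPlanar.Sched.nLast, P.root ∉ P.stepD i) (hoS : P.root ∈ P.Sfin)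
    (hkits : ∀ i ≤ ChainPlanar.Sched.nLast, ∀ j ∈ Finset.Icc P.j₀ P.j₁,
      ∃ (σ : KNLevels.SData (W × Site 2)) (Sz : Finset (W × Site 2)),
      KNLevels.SHyp (tubeLData X P.π (P.lo i) (P.hi i) P.root P.Sfin) j σ ∧ σ.N ≤ P.N ∧
      (1 - (S.p : ℝ) ^ σ.sB) ^ σ.k ≤ δ ∧ Sz ⊆ (tubeLData X P.π (P.lo i) (P.hi i) P.root P.Sfin).X j ∧ Sz ⊆ P.stepD i ∧
      (∀ x ∈ σ.K, ∀ e' ∈ σ.seed x, e' ∉ wireSet (↑Sz : Set (W × Site 2))) ∧ (∀ x ∈ σ.K, σ.face x ⊆ Sz) ∧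
      (∀ x ∈ σ.K, 1 - 3 * δ ≤ (prodBernoulli (S.Wcor (X □ zdGraph 2) FD h e (S.aOf₁ (X □ zdGraph 2) h e) a' du)).real {ω | ∃ u ∈ σ.face x,
        1 - δ < (prodBernoulli (pinW (S.Wcor (X □ zdGraph 2) FD h e (S.aOf₁ (X □ zdGraph 2) h e) a' du)
          (wireSet (↑Sz : Set (W × Site 2))) ω)).real (⋃ t ∈ P.tgtE i, openConnIn (↑(P.stepD i) : Set (W × Site 2)) u t)}))
    (hη : η ≤ δ / 2)
    (hexc : ∀ i ≤ ChainPlanar.Sched.nLast, (prodBernoulli (S.Wcor (X □ zdGraph 2) FD h e (S.aOf₁ (X □ zdGraph 2) h e) a' du)).real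
      (⋃ t ∈ P.Rim i, openConn S.Γ.root t) ≤ η)
    {π' : Finset W} (hπ' : π' ⊆ P.π) (hM0 : S.Γ.M (S.aOf₁ (X □ zdGraph 2) h e) (tgt e) ⊆ π' ×ˢ P.C.M P.x)
    (hMn : P.π ×ˢ (P.C.M (P.x + stepVec P.du) ∩ P.C.Hfull P.x P.du) ⊆ S.Γ.M a' (tgt e + stepVec du)) :
    1 - ε'' < (prodBernoulli (S.Wfull (X □ zdGraph 2) h e (S.aOf₁ (X □ zdGraph 2) h e) a' du)).real
      (S.Reach (X □ zdGraph 2) FD h e (S.aOf₁ (X □ zdGraph 2) h e) a' du) := by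
  set μ := prodBernoulli (S.Wcor (X □ zdGraph 2) FD h e (S.aOf₁ (X □ zdGraph 2) h e) a' du) with hμ
  -- the chain as `Fin (nLast + 1)`-indexed target steps
  let s : Fin (ChainPlanar.Sched.nLast + 1) → KNLevels.TStep (tubeGraph X P.π) := fun i => P.stepE X i
  let T' : Fin (ChainPlanar.Sched.nLast + 1) → Finset (W × Site 2) := fun i => P.tgtT i
  have hle : ∀ i : Fin (ChainPlanar.Sched.nLast + 1), (i : ℕ) ≤ ChainPlanar.Sched.nLast := fun i => Nat.lt_succ_iff.1 i.2
  refine hreach_of_chain_edge_sub (tubeGraph X P.π) hV hδc hchain s T' (fun i => ?_) (fun i => ?_) (fun i => ?_) (fun i => ?_) hη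
    (fun i => ?_) ?_ ?_
  · show (P.stepE X i).L.o = S.Γ.root
    rw [TubeChainData.stepE_o, hroot]
  · show P.tgtT (Fin.castSucc i) ⊆ (P.stepE X i.succ).L.X 0
    have : ((i.succ : Fin (ChainPlanar.Sched.nLast + 1)) : ℕ) = (Fin.castSucc i : ℕ) + 1 := by simp
    rw [show P.stepE X (i.succ : ℕ) = P.stepE X ((Fin.castSucc i : ℕ) + 1) by rw [this]]
    exact P.tgtT_subset_X_zero_succ X _
  · exact P.tgtT_subset_tgtE X i
  · exact TubeChainData.kitsAt_stepE X hR hRl hRim hπ (hle i) (hsub i (hle i)) hfin (hDS i (hle i)) (ho i (hle i)) hoS hj hcount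
      (hkits i (hle i))
  · refine le_trans (measureReal_mono ?_ (measure_ne_top _ _)) (hexc i (hle i))
    intro ω hω
    simp only [Set.mem_iUnion, exists_prop] at hω ⊢
    obtain ⟨t, ht, hωt⟩ := hω
    exact ⟨t, P.tgtE_sdiff_subset X i ht, hωt⟩
  · -- the arrival cube lies in the first core
    show S.Γ.M (S.aOf₁ (X □ zdGraph 2) h e) (tgt e) ⊆ (P.stepE X ((0 : Fin (ChainPlanar.Sched.nLast + 1)) : ℕ)).L.X 0
    exact hM0.trans (TubeChainData.cube_subset_X_zero X hr hR hπ')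
  · -- the last true target lies in `M_{x+du}`
    show P.tgtT ((Fin.last ChainPlanar.Sched.nLast : Fin _) : ℕ) ⊆ S.Γ.M a' (tgt e + stepVec du)
    rw [Fin.val_last]
    exact (TubeChainData.tgtT_last_subset hr hR).trans hMn

omit [Countable W] in
/-- **`cond_j` FROM ONE TUBE STEP** (design (D): the face input). [cite: KozmaNitzan2024, §4 p. 30 (Step III), Lemma 10 (p. 17)] -/
theorem cond_of_tubeStep (P : TubeStepData W) {j : ℕ} {o : Finset (Sym2 (W × Site 2))} {Δ' : ℕ} {δ₂ η : ℝ}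
    (hstep : ∀ (Wg : Sym2 (W × Site 2) → unitInterval) (s : KNLevels.TStep (tubeGraph X P.π)), s.KitsAt Wg S.p Δ' δ₂ →
      1 - δ₂ < (prodBernoulli Wg).real s.L.reachB → 1 - S.δc / 2 < (prodBernoulli Wg).real (⋃ t ∈ s.T, openConn s.L.o t))
    (hroot : P.root = S.Γ.root)
    (hsub : KNLevels.IsSubbox (tubeGraph X P.π) (S.Wt (X □ zdGraph 2) h e a a' du j o) S.p P.Rg)
    (hfin : KNLevels.FinSupp (S.Wt (X □ zdGraph 2) h e a a' du j o) P.Sfin) (hDS : P.Rg ⊆ P.Sfin)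
    (hencl : Finset.Icc (P.lo - ((P.Rlev + 1 : ℕ) : Site 2)) (P.hi + ((P.Rlev + 1 : ℕ) : Site 2)) ⊆ P.Dpl)
    (ho : P.root ∉ P.Rg) (hoS : P.root ∈ P.Sfin) (hj : P.j₁ ≤ P.Rlev) (hTD : P.T ⊆ P.Rg) (hTne : P.T.Nonempty)
    (hcount : 1 / (1 - (S.p : ℝ)) ^ (Δ' * P.N) ≤ δ₂ * ((Finset.Icc P.j₀ P.j₁).card : ℝ))
    (hkits : ∀ j' ∈ Finset.Icc P.j₀ P.j₁, ∃ (σ : KNLevels.SData (W × Site 2)) (Sz : Finset (W × Site 2)),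
      KNLevels.SHyp (tubeLData X P.π P.lo P.hi P.root P.Sfin) j' σ ∧ σ.N ≤ P.N ∧
      (1 - (S.p : ℝ) ^ σ.sB) ^ σ.k ≤ δ₂ ∧ Sz ⊆ (tubeLData X P.π P.lo P.hi P.root P.Sfin).X j' ∧ Sz ⊆ P.Rg ∧
      (∀ x ∈ σ.K, ∀ e' ∈ σ.seed x, e' ∉ wireSet (↑Sz : Set (W × Site 2))) ∧ (∀ x ∈ σ.K, σ.face x ⊆ Sz) ∧
      (∀ x ∈ σ.K, 1 - 3 * δ₂ ≤ (prodBernoulli (S.Wt (X □ zdGraph 2) h e a a' du j o)).real {ω | ∃ u ∈ σ.face x,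
        1 - δ₂ < (prodBernoulli (pinW (S.Wt (X □ zdGraph 2) h e a a' du j o) (wireSet (↑Sz : Set (W × Site 2))) ω)).real
          (⋃ t ∈ P.T, openConnIn (↑P.Rg : Set (W × Site 2)) u t)}))
    (T' : Finset (W × Site 2)) (hT' : T' ⊆ P.T) (hT'M : T' ⊆ S.Γ.M a' (tgt e + stepVec du))
    (hexc : (prodBernoulli (S.Wt (X □ zdGraph 2) h e a a' du j o)).real (⋃ t ∈ P.T \ T', openConn S.Γ.root t) ≤ η) (hη : η ≤ S.δc / 2)
    (hface : FD.Face a' (tgt e) du (j + 1) ⊆ (P.Lv X).X 0)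
    (hsrc : 1 - δ₂ < (prodBernoulli (S.Wt (X □ zdGraph 2) h e a a' du j o)).real
      (⋃ b ∈ FD.Face a' (tgt e) du (j + 1), openConn S.Γ.root b)) :
    S.cond (X □ zdGraph 2) h e a a' du j o :=
  cond_of_step (tubeGraph X P.π) hstep (P.tstep X) (by rw [TubeStepData.tstep_o, hroot])
    (TubeStepData.kitsAt_tstep hsub hfin hDS hencl ho hoS hj hTD hTne hcount hkits) T' hT' hT'M hexc hη hface hsrc

end KSchA

end KNCells

end Transplant

end Summit.CriticalPhenomena.PercolationContinuityZ3.Theorems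

end
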